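import Summits.KontsevichZagierPeriods.Zeta5Search.CalibrationAperyRates
import Summits.KontsevichZagierPeriods.Zeta5Search.CalibrationAperyDecay
import Summits.KontsevichZagierPeriods.Zeta5Search.Certificates.RowCertificate
import HarnessLib

/-!
# ζ(5) search — the Apéry row as a `RowCertificate` (calibration HIT) (cell `pub-zeta5`, certifier `cert-1`)

HONEST FRAMING: systematic search; no irrationality claim unless certified.

The calibration row of `NEAR-MISSES.md` in the format of `Certificates/RowCertificate.lean`, every
field a tree theorem: `u = q_{n,n}` (= the binomial sum `Σ C(n,k)²C(n+k,n)²`,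
`Certificates.AperyReplay.aperyB_eq_qT`), `v = p_{n,n}`, exact rates
`b = c = log(17+12√2)` (`CalibrationAperyRecurrence.tendsto_log_qT_div`,
`CalibrationAperyRecurrence.tendsto_log_abs_apery_form_div` — Poincaré + Abel), effective denominators
`Dₙ = lcm(1..n)³`, `δ = 3` (PNT in the tree), integrality (Rajkumar's table).

Outcome: `aperyRow : RowCertificate (zetaValue 3)` with
`margin = log(17+12√2) − 3 = 0.52549…` (`aperyRow_margin`, bracket `(0.5254, 0.5255)`),
`worthiness γ = 1 + (log(17+12√2) − 3)/(log(17+12√2) + 3) = 1.080529…` (bracket `(1.0805, 1.0806)`),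
`example : Irrational (zetaValue 3) := aperyRow.irrational _`, and the exponent
`¬ LiouvilleWith p (ζ(3))` for `p > 1 + (log(17+12√2)+3)/(log(17+12√2)−3) = 13.4178…` re-derived through
`RowCertificate.not_liouvilleWith` (Casoratian `6/(n+1)³ ≠ 0`). This is the reference answer any
certifier replay of a HIT must reproduce field by field.
-/

noncomputable section

open Filter Topology
open Literature.NumberTheory.Transcendental
open Literature.NumberTheory.Transcendental.Apery

namespace Summit.KontsevichZagierPeriods.Zeta5Search.Certificates

namespace AperyRow

/-! ### Certified logarithm brackets: `3.5254 < log(17+12√2) < 3.5255` -/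

/-- `3.5254 < log 33.9705627` (certified: `e^L = (e^(L/6))^6 ≤ (Taylor₁₄ + err)^6 < 33.9705627000`). -/
theorem log_apery_lo : (35254 / 10000 : ℝ) < Real.log (339705627 / 10000000 : ℝ) := by
  have hx : |(17627 / 30000 : ℝ)| ≤ 1 := by rw [abs_le]; constructor <;> norm_num
  have hb := (abs_sub_le_iff.1 (Real.exp_bound hx (n := 14) (by norm_num))).1
  norm_num [Finset.sum_range_succ, Finset.sum_range_zero, Nat.factorial] at hb
  rw [Real.lt_log_iff_exp_lt (by norm_num), show (35254 / 10000 : ℝ) = ((6:ℕ):ℝ) * (17627 / 30000 : ℝ) by norm_num,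
    Real.exp_nat_mul]
  exact lt_of_le_of_lt (pow_le_pow_left₀ (Real.exp_pos _).le hb 6) (by norm_num)

/-- `log 33.9705628 < 3.5255` (certified: `e^U = (e^(U/6))^6 ≥ (Taylor₁₄ − err)^6 > 33.9705628000`). -/
theorem log_apery_hi : Real.log (339705628 / 10000000 : ℝ) < (35255 / 10000 : ℝ) := by
  have hx : |(7051 / 12000 : ℝ)| ≤ 1 := by rw [abs_le]; constructor <;> norm_num
  have hb := (abs_sub_le_iff.1 (Real.exp_bound hx (n := 14) (by norm_num))).2
  norm_num [Finset.sum_range_succ, Finset.sum_range_zero, Nat.factorial] at hb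
  have h1 := sub_le_iff_le_add'.mpr hb
  rw [Real.log_lt_iff_lt_exp (by norm_num), show (35255 / 10000 : ℝ) = ((6:ℕ):ℝ) * (7051 / 12000 : ℝ) by norm_num,
    Real.exp_nat_mul]
  exact lt_of_lt_of_le (by norm_num) (pow_le_pow_left₀ (by norm_num) h1 6)


/-- `33.9705627 < 17 + 12√2 < 33.9705628` (from `1.414213562 < √2 < 1.414213563`). -/
theorem apery_base_mem :
    (339705627 / 10000000 : ℝ) < 17 + 12 * Real.sqrt 2 ∧ 17 + 12 * Real.sqrt 2 < (339705628 / 10000000 : ℝ) := by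
  have h1 : (1414213562 / 10 ^ 9 : ℝ) < Real.sqrt 2 := by
    rw [Real.lt_sqrt (by norm_num)]; norm_num
  have h2 : Real.sqrt 2 < (1414213563 / 10 ^ 9 : ℝ) := by
    rw [Real.sqrt_lt' (by norm_num)]; norm_num
  constructor <;> linarith

/-- **`3.5254 < log(17+12√2) < 3.5255`** (`log(17+12√2) = 4 log(1+√2) = 3.5254943…`). -/
theorem log_apery_mem :
    (35254 / 10000 : ℝ) < Real.log (17 + 12 * Real.sqrt 2) ∧
      Real.log (17 + 12 * Real.sqrt 2) < (35255 / 10000 : ℝ) := by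
  obtain ⟨h1, h2⟩ := apery_base_mem
  have hpos : (0 : ℝ) < 339705627 / 10000000 := by norm_num
  constructor
  · exact log_apery_lo.trans (Real.log_lt_log hpos h1)
  · exact (Real.log_lt_log (hpos.trans h1) h2).trans log_apery_hi

/-! ### The row -/

/-- **The Apéry row**: `u = q_{n,n}`, `v = p_{n,n}`, `b = c = log(17+12√2)`, `Dₙ = lcm(1..n)³`, `δ = 3`. -/
def aperyRow : RowCertificate (zetaValue 3) where
  u n := qT n n
  v n := pT n n
  growthRate := Real.log (17 + 12 * Real.sqrt 2)
  decayRate := Real.log (17 + 12 * Real.sqrt 2)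
  tendsto_growth := by
    refine CalibrationAperyRecurrence.tendsto_log_qT_div.congr' (Eventually.of_forall fun n => ?_)
    simp only [abs_of_pos (qT_pos_real n n)]
  tendsto_decay := CalibrationAperyRecurrence.tendsto_log_abs_apery_form_div
  decayRate_pos := Real.log_pos (by linarith [apery_base_mem.1])
  denom n := Nat.lcmUpto n ^ 3
  denom_pos n := pow_pos (Nat.lcmUpto_pos n) 3
  denomRate := 3
  tendsto_denom := by
    have h := tendsto_log_lcmUpto_div.const_mul 3
    rw [mul_one] at h
    refine h.congr' (Eventually.of_forall fun n => ?_)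
    have h0 : (0 : ℝ) < Nat.lcmUpto n := by exact_mod_cast Nat.lcmUpto_pos n
    push_cast
    rw [Real.log_pow]
    push_cast
    ring
  isInt_u := Eventually.of_forall fun n => by
    obtain ⟨z, hz⟩ := qT_isInt n n
    refine ⟨(Nat.lcmUpto n : ℤ) ^ 3 * z, ?_⟩
    rw [hz]; push_cast; ring
  isInt_v := Eventually.of_forall fun n => by
    obtain ⟨z, hz⟩ := lcmUpto_cube_mul_pT_isInt n n n le_rfl le_rfl
    exact ⟨z, by push_cast; exact hz⟩

/-- The margin of the Apéry row: `μ₁ = log(17+12√2) − 3`. -/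
theorem aperyRow_margin : aperyRow.margin = Real.log (17 + 12 * Real.sqrt 2) - 3 := rfl

/-- `0.5254 < μ₁ < 0.5255` (`μ₁ = 0.5254943…`); in particular the row is a HIT. -/
theorem aperyRow_margin_mem :
    (5254 / 10000 : ℝ) < aperyRow.margin ∧ aperyRow.margin < (5255 / 10000 : ℝ) := by
  rw [aperyRow_margin]
  obtain ⟨h1, h2⟩ := log_apery_mem
  constructor <;> linarith

/-- The margin is positive. -/
theorem aperyRow_margin_pos : 0 < aperyRow.margin := by linarith [aperyRow_margin_mem.1]

/-- The coefficient rate of the Apéry row: `Q = log(17+12√2) + 3`. -/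
theorem aperyRow_coeffRate : aperyRow.coeffRate = Real.log (17 + 12 * Real.sqrt 2) + 3 := rfl

/-- The worthiness of the Apéry row: `γ = 1 + (log(17+12√2) − 3)/(log(17+12√2) + 3)`. -/
theorem aperyRow_worthiness :
    aperyRow.worthiness =
      1 + (Real.log (17 + 12 * Real.sqrt 2) - 3) / (Real.log (17 + 12 * Real.sqrt 2) + 3) := rfl

/-- **`1.0805 < γ < 1.0806`** (`γ = 1.0805294…`: `|ζ(3) − aₙ/bₙ| = (Dₙbₙ)^{−γ+o(1)}`). -/
theorem aperyRow_worthiness_mem :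
    (10805 / 10000 : ℝ) < aperyRow.worthiness ∧ aperyRow.worthiness < (10806 / 10000 : ℝ) := by
  rw [aperyRow_worthiness]
  obtain ⟨h1, h2⟩ := log_apery_mem
  set L := Real.log (17 + 12 * Real.sqrt 2) with hL
  have hQ : 0 < L + 3 := by linarith
  constructor
  · have : (805 / 10000 : ℝ) * (L + 3) < L - 3 := by linarith
    have := (lt_div_iff₀ hQ).2 this
    linarith
  · have : L - 3 < (806 / 10000 : ℝ) * (L + 3) := by linarith
    have := (div_lt_iff₀ hQ).2 this
    linarith

/-- End-to-end through the row format: `ζ(3) ∉ ℚ` (an `example`; the statement is the tree's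
`Apery.irrational_zeta_three`). -/
example : Irrational (zetaValue 3) := aperyRow.irrational aperyRow_margin_pos

/-- The Casoratian of the row never vanishes: `q_{n,n}p_{n+1,n+1} − q_{n+1,n+1}p_{n,n} = 6/(n+1)³`. -/
theorem aperyRow_casoratian_ne_zero (n : ℕ) :
    aperyRow.u n * aperyRow.v (n + 1) ≠ aperyRow.u (n + 1) * aperyRow.v n := by
  intro h
  have hc := CalibrationAperyRecurrence.diag_casoratian n
  change qT n n * pT (n + 1) (n + 1) = qT (n + 1) (n + 1) * pT n n at h
  rw [h, sub_self] at hc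
  have : (0 : ℚ) < 6 / ((n : ℚ) + 1) ^ 3 := by positivity
  linarith

/-- **Apéry's exponent through the row format**: `¬ LiouvilleWith p (ζ(3))` for every
`p > 1 + (log(17+12√2) + 3)/(log(17+12√2) − 3) = 13.41782…` — an `example`, since the statement is
the tree's `CalibrationAperyRecurrence.not_liouvilleWith_zetaThree`; here it is re-derived from
`RowCertificate.not_liouvilleWith`. -/
example {p : ℝ}
    (hp : 1 + (Real.log (17 + 12 * Real.sqrt 2) + 3) / (Real.log (17 + 12 * Real.sqrt 2) - 3) < p) :
    ¬ LiouvilleWith p (zetaValue 3) :=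
  aperyRow.not_liouvilleWith aperyRow_margin_pos (by rw [aperyRow_coeffRate]; linarith [log_apery_mem.1])
    (Eventually.of_forall aperyRow_casoratian_ne_zero) hp

end AperyRow

end Summit.KontsevichZagierPeriods.Zeta5Search.Certificates
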